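import Literature.Algebra.EuclideanLattices.LLLAlgorithmInvariant
import HarnessLib

/-!
# The Gram–Schmidt vectors of the reversed dual basis (Peikert 2009, Lemma 2.3)

Topic `Algebra/EuclideanLattices` (family `pqc`). Peikert, *Public-key cryptosystems from the worst-case
shortest vector problem* (STOC 2009; full version Lemma 2.3): *let `B` be a basis and `D = B^{-t}` its
dual basis; if `d̃₁, …, d̃ₙ` are the Gram–Schmidt vectors of `D` processed IN REVERSE ORDER, then
`d̃ᵢ = b̃ᵢ/‖b̃ᵢ‖²`, in particular `‖d̃ᵢ‖ = 1/‖b̃ᵢ‖`* (folklore; e.g. Regev's lecture notes on lattices,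
Lecture 8). It is the step of Peikert's `GapSVP → LWE` reduction (proof of Thm. 3.1; hypothesis `h₂` of
`peikert_gapSVPZeta_to_lwe_classical_of_components`, pqc.S20) that turns the promise `minᵢ‖b̃ᵢ‖ ≥ 1` on
the INPUT basis into the hypothesis `r ≥ maxᵢ‖d̃ᵢ‖·ω(√(log n))` of the GPV sampler (Prop. 2.8) run on
the reversed dual basis of `Λ*`. Everything here is PROVED (Mathlib's `InnerProductSpace.gramSchmidt`,
indexed by `Fin n`, reversal `Fin.rev`); no definition, no named fact.

* (used, from `LLLAlgorithmInvariant.lean`) `eq_gramSchmidt_of_sub_mem_span` — the characterisation of a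
  Gram–Schmidt vector: the unique `v` with `v ⊥ span{fⱼ : j < i}` and `v - fᵢ ∈ span{fⱼ : j < i}` is `f̃ᵢ`;
  here `inner_eq_zero_of_forall_generators` (orthogonality to the generators suffices);
* `repr_dual_eq_inner` (`v = ∑ⱼ ⟪v, bⱼ⟫ dⱼ` for biorthogonal `b`, `d`), `inner_gramSchmidt_self`
  (`⟪b̃ₘ, bₘ⟫ = ‖b̃ₘ‖²`);
* **`gramSchmidt_dual_rev`** — `(d ∘ rev)~ᵢ = b̃_{rev i}/‖b̃_{rev i}‖²`, and
  **`norm_gramSchmidt_dual_rev`** — `‖(d ∘ rev)~ᵢ‖ = 1/‖b̃_{rev i}‖`, for a linearly independent `b` and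
  a basis `d` with `⟪bᵢ, dⱼ⟫ = δᵢⱼ`.

## References

* C. Peikert, *Public-key cryptosystems from the worst-case shortest vector problem*, STOC 2009, full
  version (Dagstuhl Seminar Proc. 08491), Lemma 2.3 and the proof of Thm. 3.1 [Peikert2009].
* O. Regev, *Lattices in Computer Science*, lecture notes (Tel Aviv University, 2004), Lecture 8, "Dual
  lattices" (the reversed dual Gram–Schmidt basis) — folklore source.
-/

noncomputable section

open InnerProductSpace Submodule Finset Module
open scoped RealInnerProductSpace

namespace Literature.Algebra.EuclideanLattices

variable {V : Type*} [NormedAddCommGroup V] [InnerProductSpace ℝ V]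

/-! ### Two complements to the characterisation of a Gram–Schmidt vector -/

section Unique

variable {ι : Type*} [LinearOrder ι] [LocallyFiniteOrderBot ι] [WellFoundedLT ι]

omit [LocallyFiniteOrderBot ι] [WellFoundedLT ι] in
/-- Orthogonality to the generators `fⱼ`, `j < i`, gives orthogonality to their span. [folklore] -/
theorem inner_eq_zero_of_forall_generators (f : ι → V) (i : ι) {v : V} (horth : ∀ j < i, ⟪v, f j⟫ = 0) :
    ∀ u ∈ span ℝ (f '' Set.Iio i), ⟪u, v⟫ = 0 := by
  intro u hu
  induction hu using Submodule.span_induction with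
  | mem x hx =>
    obtain ⟨j, hj, rfl⟩ := hx
    rw [real_inner_comm]
    exact horth j hj
  | zero => exact inner_zero_left _
  | add x y _ _ hx hy => rw [inner_add_left, hx, hy, add_zero]
  | smul a x _ hx => rw [real_inner_smul_left, hx, mul_zero]

/-- `⟪b̃ₘ, bₘ⟫ = ‖b̃ₘ‖²` (`bₘ - b̃ₘ` lies in `span{bⱼ : j < m} ⊥ b̃ₘ`). [folklore] -/
theorem inner_gramSchmidt_self (f : ι → V) (m : ι) :
    ⟪gramSchmidt ℝ f m, f m⟫ = ‖gramSchmidt ℝ f m‖ ^ 2 := by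
  have h : f m = gramSchmidt ℝ f m - (gramSchmidt ℝ f m - f m) := by abel
  conv_lhs => rw [h]
  rw [inner_sub_right, real_inner_self_eq_norm_sq, real_inner_comm,
    inner_gramSchmidt_eq_zero_of_mem_span f (gramSchmidt_sub_self_mem_span f m), sub_zero]

end Unique

/-! ### Dual bases and the reversed Gram–Schmidt process -/

section Dual

variable {n : ℕ} {b : Fin n → V} {d : Basis (Fin n) ℝ V}

/-- **Coordinates in the dual basis are pairings with the primal family**: if `⟪bᵢ, dⱼ⟫ = δᵢⱼ` then
`(d⁻¹v)ⱼ = ⟪v, bⱼ⟫`, i.e. `v = ∑ⱼ ⟪v, bⱼ⟫ dⱼ`. [folklore] -/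
theorem repr_dual_eq_inner (hbd : ∀ i j, ⟪b i, d j⟫ = if i = j then (1 : ℝ) else 0) (v : V) (j : Fin n) :
    d.repr v j = ⟪v, b j⟫ := by
  conv_rhs => rw [← d.sum_repr v]
  rw [sum_inner]
  simp_rw [real_inner_smul_left, real_inner_comm (b j), hbd]
  simp

/-- A vector orthogonal to `b₀, …, bₘ` lies in `span{dₖ : k > m}`. [folklore] -/
theorem mem_span_dual_of_inner_eq_zero (hbd : ∀ i j, ⟪b i, d j⟫ = if i = j then (1 : ℝ) else 0) {v : V}
    (m : Fin n) (hv : ∀ k ≤ m, ⟪v, b k⟫ = 0) : v ∈ span ℝ (d '' Set.Ioi m) := by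
  rw [← d.sum_repr v]
  refine sum_mem fun k _ => ?_
  by_cases hk : m < k
  · exact smul_mem _ _ (subset_span ⟨k, hk, rfl⟩)
  · rw [repr_dual_eq_inner hbd, hv k (not_lt.1 hk), zero_smul]
    exact zero_mem _

/-- A vector of `span{b₀, …, bₘ}` is orthogonal to `dₗ` for `l > m`. [folklore] -/
theorem inner_dual_eq_zero_of_mem_span (hbd : ∀ i j, ⟪b i, d j⟫ = if i = j then (1 : ℝ) else 0) {u : V}
    {m l : Fin n} (hml : m < l) (hu : u ∈ span ℝ (b '' Set.Iic m)) : ⟪u, d l⟫ = 0 := by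
  induction hu using Submodule.span_induction with
  | mem x hx =>
    obtain ⟨k, hk, rfl⟩ := hx
    rw [hbd, if_neg]
    exact (ne_of_lt (lt_of_le_of_lt (Set.mem_Iic.1 hk) hml))
  | zero => exact inner_zero_left _
  | add x y _ _ hx hy => rw [inner_add_left, hx, hy, add_zero]
  | smul a x _ hx => rw [real_inner_smul_left, hx, mul_zero]

/-- **Peikert 2009, Lemma 2.3 (the reversed dual Gram–Schmidt vectors).** For a linearly independent
family `b₀, …, b_{n-1}` and a basis `d` with `⟪bᵢ, dⱼ⟫ = δᵢⱼ` (the dual basis), the `i`-th Gram–Schmidt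
vector of `d` taken in reverse order is `b̃_{rev i}/‖b̃_{rev i}‖²` (Peikert: "`d̃ᵢ = b̃ᵢ/‖b̃ᵢ‖²` when the
dual basis is processed in reverse"). [cite: Peikert2009, Lemma 2.3 (full version)] -/
theorem gramSchmidt_dual_rev (hb : LinearIndependent ℝ b)
    (hbd : ∀ i j, ⟪b i, d j⟫ = if i = j then (1 : ℝ) else 0) (i : Fin n) :
    gramSchmidt ℝ (d ∘ Fin.rev) i =
      (‖gramSchmidt ℝ b (Fin.rev i)‖ ^ 2)⁻¹ • gramSchmidt ℝ b (Fin.rev i) := by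
  set m := Fin.rev i with hm
  have hne : gramSchmidt ℝ b m ≠ 0 := gramSchmidt_ne_zero m hb
  have hnorm : ‖gramSchmidt ℝ b m‖ ^ 2 ≠ 0 := pow_ne_zero 2 (norm_ne_zero_iff.2 hne)
  symm
  refine eq_gramSchmidt_of_sub_mem_span (d ∘ Fin.rev) ?_
    (inner_eq_zero_of_forall_generators (d ∘ Fin.rev) i fun j hj => ?_)
  · -- `b̃ₘ/‖b̃ₘ‖² - dₘ ∈ span{d_k : k > m} = span{(d ∘ rev)ⱼ : j < i}`
    have himage : (d ∘ Fin.rev) '' Set.Iio i = d '' Set.Ioi m := by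
      ext x
      simp only [Set.mem_image, Set.mem_Iio, Set.mem_Ioi, Function.comp_apply]
      constructor
      · rintro ⟨j, hj, rfl⟩
        exact ⟨Fin.rev j, Fin.rev_lt_rev.2 hj, rfl⟩
      · rintro ⟨k, hk, rfl⟩
        refine ⟨Fin.rev k, ?_, by rw [Fin.rev_rev]⟩
        rw [← Fin.rev_lt_rev, Fin.rev_rev]
        exact hk
    rw [himage, Function.comp_apply, ← hm]
    refine mem_span_dual_of_inner_eq_zero hbd m fun k hk => ?_
    rw [inner_sub_left, real_inner_smul_left, real_inner_comm (b k) (d m), hbd]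
    rcases hk.lt_or_eq with hlt | rfl
    · rw [gramSchmidt_inv_triangular ℝ b hlt, if_neg (ne_of_lt hlt), mul_zero, sub_zero]
    · rw [inner_gramSchmidt_self, if_pos rfl, inv_mul_cancel₀ hnorm, sub_self]
  · -- orthogonality to `d (rev j)`, `rev j > m`: `b̃ₘ ∈ span{bₖ : k ≤ m}`
    rw [real_inner_smul_left, Function.comp_apply,
      inner_dual_eq_zero_of_mem_span hbd (Fin.rev_lt_rev.2 hj) (gramSchmidt_mem_span ℝ b le_rfl), mul_zero]

/-- **Peikert 2009, Lemma 2.3 (norm form): `‖d̃ᵢ‖ = 1/‖b̃_{rev i}‖`** for the dual basis processed in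
reverse order — so `minᵢ‖b̃ᵢ‖ ≥ s` gives `maxᵢ‖d̃ᵢ‖ ≤ 1/s`, the form consumed by the GPV sampler on
`Λ*`. [cite: Peikert2009, Lemma 2.3 (full version)] -/
theorem norm_gramSchmidt_dual_rev (hb : LinearIndependent ℝ b)
    (hbd : ∀ i j, ⟪b i, d j⟫ = if i = j then (1 : ℝ) else 0) (i : Fin n) :
    ‖gramSchmidt ℝ (d ∘ Fin.rev) i‖ = ‖gramSchmidt ℝ b (Fin.rev i)‖⁻¹ := by
  have hne : gramSchmidt ℝ b (Fin.rev i) ≠ 0 := gramSchmidt_ne_zero _ hb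
  have hpos : 0 < ‖gramSchmidt ℝ b (Fin.rev i)‖ := norm_pos_iff.2 hne
  rw [gramSchmidt_dual_rev hb hbd i, norm_smul, norm_inv, norm_pow, Real.norm_eq_abs, abs_norm]
  field_simp

/-- Consequence: a lower bound `s ≤ ‖b̃ⱼ‖` on all primal Gram–Schmidt norms is an upper bound
`‖d̃ᵢ‖ ≤ 1/s` on all reversed dual ones. [cite: Peikert2009, Lemma 2.3 with the proof of Thm. 3.1] -/
theorem norm_gramSchmidt_dual_rev_le (hb : LinearIndependent ℝ b)
    (hbd : ∀ i j, ⟪b i, d j⟫ = if i = j then (1 : ℝ) else 0) {s : ℝ} (hs : 0 < s)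
    (h : ∀ j, s ≤ ‖gramSchmidt ℝ b j‖) (i : Fin n) :
    ‖gramSchmidt ℝ (d ∘ Fin.rev) i‖ ≤ s⁻¹ := by
  rw [norm_gramSchmidt_dual_rev hb hbd i]
  exact inv_anti₀ hs (h _)

end Dual

end Literature.Algebra.EuclideanLattices
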